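import Mathlib
import Summits.ResolutionOfSingularities.ResolutionOfSingularities.Theorems.ValuativeLuAlphaPTorsorAPTorsion
import HarnessLib

/-!
# From étale coordinates at the centre to a Hensel-over-ruled presentation
(crux `SemivaluationShadows`, line `birth`; surface bridge, algebraic half)

Registered sub-goal `exists_henselPresentation_of_coordinates` of the crux
`stmt-ResolutionOfSingularities-16757` (`Theses.AbhyankarShadows.SemivaluationShadows`), line
`birth`. The SURFACE BRIDGE of CORE.md reduces the rational-rank-one core of the crux for surfaces
to Lipman's theorem: a valuation centred at a REGULAR point of a surface over `k = k̄` admits étale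
coordinates, i.e. `K = k(u₀, u₁)(η)` with `u₀, u₁` algebraically independent elements of the
valuation ring and `η ∈ O` a root of a monic `h` over `k[u₀, u₁]` with `h'(η)` a unit of `O`
(standard-étale chart). This file is the elementary half: such coordinates give the presentation
consumed by the registered stub `stub_henselOverRuledShadowsRankOne` of the line — base field
`K₀ = k(u₀)`, on which `ν` is the `t`-adic valuation for `t = u₀ - c₀` (`c₀` the residue constant
of `u₀`), `v = u₁` transcendental over `K₀`, and the Hensel root `η`.

* (constants are units: reused from `PfaffLine.ap_valuation_algebraMap_eq_one`)
* `valuation_aeval_eq_pow_of_lt_one` — for `t ∈ O` with `ν(t) < 1` and a polynomial `P`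
  over `k` with `P(t) ≠ 0`, `ν(P(t)) = ν(t)^m` for some `m : ℕ` (the `t`-adic valuation).
* `valuation_eq_zpow_of_mem_adjoin_simple` — hence every non-zero element of `k(u₀) = k(t)` has
  value an integral power of `ν(t)`.
* `exists_henselPresentation_of_coordinates` — the registered statement (conclusion = the Hensel
  presentation predicate of the line's composition, verbatim).

## Sources
* folklore (the Gauss/`t`-adic valuation on `k(t)`; bookkeeping of adjunctions).
-/

-- single-problem summit: the doubled namespace component `ResolutionOfSingularities` is forced
set_option linter.dupNamespace false

noncomputable section

namespace Summit.ResolutionOfSingularities.ResolutionOfSingularities.Theorems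

open Polynomial

variable {k K : Type} [Field k] [Field K] [Algebra k K]

/-- **The `t`-adic valuation on `k[t]`.** If the constants lie in `O`, `t ∈ O` has `ν(t) < 1` and
`P(t) ≠ 0` for a polynomial `P` over `k` of degree `≤ n`, then `ν(P(t)) = ν(t)^m` for some `m : ℕ`
(namely the order of vanishing of `P` at `0`). [folklore] -/
theorem valuation_aeval_eq_pow_of_lt_one (O : ValuationSubring K)
    (hk : ∀ c : k, algebraMap k K c ∈ O) {t : K} (htO : t ∈ O) (ht1 : O.valuation t < 1) :
    ∀ (n : ℕ) (P : k[X]), P.natDegree ≤ n → aeval t P ≠ 0 →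
      ∃ m : ℕ, O.valuation (aeval t P) = O.valuation t ^ m := by
  -- `O` as a `k`-subalgebra, to evaluate polynomials inside it
  let OA : Subalgebra k K := ⟨O.toSubring.toSubsemiring, fun c => hk c⟩
  have hmemO : ∀ Q : k[X], aeval t Q ∈ O := fun Q =>
    (show Algebra.adjoin k {t} ≤ OA from
      Algebra.adjoin_le (Set.singleton_subset_iff.mpr htO)) (aeval_mem_adjoin_singleton k t)
  intro n
  induction n with
  | zero =>
    intro P hP hP0
    obtain ⟨c, rfl⟩ := natDegree_eq_zero.mp (Nat.le_zero.mp hP)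
    refine ⟨0, ?_⟩
    rw [aeval_C, pow_zero]
    refine PfaffLine.ap_valuation_algebraMap_eq_one O hk ?_
    rintro rfl
    exact hP0 (by simp)
  | succ n ih =>
    intro P hP hP0
    -- `P = X * P.divX + C (P.coeff 0)`
    have hdecomp : P = X * P.divX + C (P.coeff 0) := by
      conv_lhs => rw [← P.divX_mul_X_add]
      ring
    have hdivdeg : P.divX.natDegree ≤ n := by
      rw [natDegree_divX_eq_natDegree_tsub_one]
      omega
    have hXt : aeval t (X * P.divX) = t * aeval t P.divX := by rw [map_mul, aeval_X]
    by_cases h0 : P.coeff 0 = 0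
    · -- `P(t) = t * P.divX(t)`
      have hPt : aeval t P = t * aeval t P.divX := by
        conv_lhs => rw [hdecomp]
        rw [map_add, hXt, h0, map_zero, map_zero, add_zero]
      have hdiv0 : aeval t P.divX ≠ 0 := by
        intro h
        exact hP0 (by rw [hPt, h, mul_zero])
      obtain ⟨m, hm⟩ := ih P.divX hdivdeg hdiv0
      exact ⟨m + 1, by rw [hPt, map_mul, hm, pow_succ, mul_comm]⟩
    · -- the constant term dominates
      refine ⟨0, ?_⟩
      have hc : O.valuation (aeval t (C (P.coeff 0))) = 1 := by
        rw [aeval_C]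
        exact PfaffLine.ap_valuation_algebraMap_eq_one O hk h0
      have hlt : O.valuation (aeval t (X * P.divX)) < O.valuation (aeval t (C (P.coeff 0))) := by
        rw [hc, hXt, map_mul]
        calc O.valuation t * O.valuation (aeval t P.divX) ≤ O.valuation t * 1 := by
              gcongr
              exact (O.valuation_le_one_iff _).mpr (hmemO _)
          _ = O.valuation t := mul_one _
          _ < 1 := ht1
      rw [pow_zero]
      conv_lhs => rw [hdecomp]
      rw [map_add, Valuation.map_add_eq_of_lt_right _ hlt]
      exact hc

/-- Every non-zero element of `k(u₀)` has value an integral power of `ν(t)`, `t = u₀ - c₀ ≠ 0`,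
when `t ∈ O` and `ν(t) < 1` (so `ν|k(u₀)` is the `t`-adic valuation). [folklore] -/
theorem valuation_eq_zpow_of_mem_adjoin_simple (O : ValuationSubring K)
    (hk : ∀ c : k, algebraMap k K c ∈ O) {u₀ : K} {c₀ : k}
    (ht0 : u₀ - algebraMap k K c₀ ≠ 0) (htO : u₀ - algebraMap k K c₀ ∈ O)
    (ht1 : O.valuation (u₀ - algebraMap k K c₀) < 1) {x : K}
    (hx : x ∈ IntermediateField.adjoin k {u₀}) (hx0 : x ≠ 0) :
    ∃ m : ℤ, O.valuation x = O.valuation (u₀ - algebraMap k K c₀) ^ m := by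
  set t : K := u₀ - algebraMap k K c₀ with ht
  rw [IntermediateField.mem_adjoin_simple_iff] at hx
  obtain ⟨r, s, rfl⟩ := hx
  -- rewrite `aeval u₀` as `aeval t` of the Taylor shift
  have hshift : ∀ q : k[X], aeval u₀ q = aeval t (q.comp (X + C c₀)) := by
    intro q
    rw [aeval_comp, map_add, aeval_X, aeval_C, ht, sub_add_cancel]
  have hr0 : aeval t (r.comp (X + C c₀)) ≠ 0 := by
    intro h; rw [← hshift] at h; exact hx0 (by rw [h, zero_div])
  have hs0 : aeval t (s.comp (X + C c₀)) ≠ 0 := by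
    intro h; rw [← hshift] at h; exact hx0 (by rw [h, div_zero])
  obtain ⟨mr, hmr⟩ := valuation_aeval_eq_pow_of_lt_one O hk htO ht1 _ _ le_rfl hr0
  obtain ⟨ms, hms⟩ := valuation_aeval_eq_pow_of_lt_one O hk htO ht1 _ _ le_rfl hs0
  have hvt0 : O.valuation t ≠ 0 := (Valuation.ne_zero_iff _).mpr ht0
  refine ⟨(mr : ℤ) - ms, ?_⟩
  rw [hshift r, hshift s, map_div₀, hmr, hms, ← zpow_natCast, ← zpow_natCast,
    ← zpow_sub₀ hvt0]

/-- **Étale coordinates give a Hensel-over-ruled presentation** (registered sub-goal of the crux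
`SemivaluationShadows`, line `birth`; the algebraic half of the SURFACE BRIDGE). Let `O ⊇ k` be a
valuation ring of `K` all of whose residues are constants, `u₀, u₁ ∈ O` algebraically independent
over `k`, and `η ∈ O` a root of a monic `h` with coefficients in `k[u₀, u₁]` such that `h'(η)` is a
unit of `O` and `K = k(u₀, u₁, η)`. Then `(K, O)` has the presentation consumed by the stub
`stub_henselOverRuledShadowsRankOne`: `K₀ = k(u₀)` with `ν|K₀` the `t`-adic valuation
(`t = u₀ - c₀`), `v = u₁` transcendental over `K₀`, and the Hensel root `η` of `h` over
`K₀(v) ∩ O`, with `K₀(v, η) = K`. [folklore] -/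
theorem exists_henselPresentation_of_coordinates : ∀ (k K : Type) [Field k] [Field K] [Algebra k K] (O : ValuationSubring K), (∀ c : k, algebraMap k K c ∈ O) → (∀ x : K, x ∈ O → ∃ c : k, O.valuation (x - algebraMap k K c) < 1) → ∀ (u₀ u₁ η : K) (h : Polynomial K), AlgebraicIndependent k ![u₀, u₁] → u₀ ∈ O → u₁ ∈ O → η ∈ O → (∀ i : ℕ, h.coeff i ∈ Algebra.adjoin k ({u₀, u₁} : Set K)) → h.Monic → Polynomial.aeval η h = 0 → O.valuation (Polynomial.aeval η (Polynomial.derivative h)) = 1 → IntermediateField.adjoin k ({u₀, u₁, η} : Set K) = ⊤ → ∃ (K₀ : IntermediateField k K) (t v η : K) (h : Polynomial K), t ∈ K₀ ∧ t ≠ 0 ∧ O.valuation t < 1 ∧ (∀ x : K, x ∈ K₀ → x ≠ 0 → ∃ m : ℤ, O.valuation x = O.valuation t ^ m) ∧ Transcendental K₀ v ∧ (∀ i : ℕ, h.coeff i ∈ IntermediateField.adjoin K₀ {v} ∧ h.coeff i ∈ O) ∧ h.Monic ∧ Polynomial.aeval η h = 0 ∧ O.valuation (Polynomial.aeval η (Polynomial.derivative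 h)) = 1 ∧ η ∈ O ∧ IntermediateField.adjoin K₀ {v, η} = ⊤ := by
  intro k K _ _ _ O hk hrat u₀ u₁ η h hind hu₀ hu₁ hη hcoef hmon hroot hder hgen
  classical
  -- the base field `K₀ = k(u₀)` and the uniformiser-like `t = u₀ - c₀`
  let K₀ : IntermediateField k K := IntermediateField.adjoin k {u₀}
  obtain ⟨c₀, hc₀⟩ := hrat u₀ hu₀
  set t : K := u₀ - algebraMap k K c₀ with ht
  have hu₀K₀ : u₀ ∈ K₀ := IntermediateField.mem_adjoin_simple_self k u₀
  have htK₀ : t ∈ K₀ := sub_mem hu₀K₀ (K₀.algebraMap_mem c₀)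
  have htO : t ∈ O := sub_mem hu₀ (hk c₀)
  have hu₀tr : Transcendental k u₀ := by simpa using hind.transcendental 0
  have ht0 : t ≠ 0 := by
    intro h0
    apply hu₀tr
    rw [ht, sub_eq_zero] at h0
    rw [h0]
    exact isAlgebraic_algebraMap c₀
  -- `O` as a `k`-subalgebra
  let OA : Subalgebra k K := ⟨O.toSubring.toSubsemiring, fun c => hk c⟩
  have hadjO : Algebra.adjoin k ({u₀, u₁} : Set K) ≤ OA :=
    Algebra.adjoin_le (Set.pair_subset_iff.mpr ⟨hu₀, hu₁⟩)
  -- `v = u₁` is transcendental over `K₀`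
  have hv : Transcendental K₀ u₁ := by
    have h1 := hind.transcendental_adjoin (s := {0}) (i := 1) (by simp)
    have h2 : Transcendental (IntermediateField.adjoin k (![u₀, u₁] '' ({0} : Set (Fin 2)))) u₁ :=
      IntermediateField.transcendental_adjoin_iff.mpr h1
    have hset : IntermediateField.adjoin k (![u₀, u₁] '' ({0} : Set (Fin 2))) = K₀ := by
      simp [K₀]
    rw [hset] at h2
    exact h2
  -- the intermediate field `K₀(u₁)` contains `k[u₀, u₁]`
  let K₁ : IntermediateField K₀ K := IntermediateField.adjoin K₀ {u₁}
  have hadjK₁ : Algebra.adjoin k ({u₀, u₁} : Set K) ≤ (K₁.restrictScalars k).toSubalgebra := by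
    refine Algebra.adjoin_le (Set.pair_subset_iff.mpr ⟨?_, ?_⟩)
    · show u₀ ∈ K₁.restrictScalars k
      rw [IntermediateField.mem_restrictScalars]
      exact K₁.algebraMap_mem ⟨u₀, hu₀K₀⟩
    · show u₁ ∈ K₁.restrictScalars k
      rw [IntermediateField.mem_restrictScalars]
      exact IntermediateField.mem_adjoin_simple_self K₀ u₁
  refine ⟨K₀, t, u₁, η, h, htK₀, ht0, hc₀, ?_, hv, ?_, hmon, hroot, hder, hη, ?_⟩
  · -- `ν|K₀` is `t`-adic
    intro x hx hx0
    exact valuation_eq_zpow_of_mem_adjoin_simple O hk ht0 htO hc₀ hx hx0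
  · -- coefficients of `h`
    intro i
    refine ⟨?_, hadjO (hcoef i)⟩
    have := hadjK₁ (hcoef i)
    rwa [IntermediateField.mem_toSubalgebra, IntermediateField.mem_restrictScalars] at this
  · -- `K₀(u₁, η) = K`
    rw [eq_top_iff]
    intro x _
    have hxtop : x ∈ (⊤ : IntermediateField k K) := IntermediateField.mem_top
    rw [← hgen] at hxtop
    have hle : IntermediateField.adjoin k ({u₀, u₁, η} : Set K) ≤
        (IntermediateField.adjoin K₀ ({u₁, η} : Set K)).restrictScalars k := by
      rw [IntermediateField.adjoin_le_iff]
      intro y hy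
      rw [SetLike.mem_coe, IntermediateField.mem_restrictScalars]
      simp only [Set.mem_insert_iff, Set.mem_singleton_iff] at hy
      rcases hy with hy | hy | hy <;> rw [hy]
      · exact (IntermediateField.adjoin K₀ ({u₁, η} : Set K)).algebraMap_mem ⟨u₀, hu₀K₀⟩
      · exact IntermediateField.subset_adjoin K₀ _ (Set.mem_insert u₁ _)
      · exact IntermediateField.subset_adjoin K₀ _ (Set.mem_insert_of_mem _ rfl)
    have := hle hxtop
    rwa [IntermediateField.mem_restrictScalars] at this

end Summit.ResolutionOfSingularities.ResolutionOfSingularities.Theorems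

end
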